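import Literature.NumberTheory.Transcendental.GammaIsoCrossGeometric
import Literature.NumberTheory.Transcendental.ZilberProp112Twisted
import HarnessLib

/-!
# Bays–Kirby 2018, Prop. 11.2 over an isomorphism of Γ-closed bases, across two fields

Two-field port of `GammaIsoTwistedAbsorption.lean` and `ZilberProp112Twisted.lean` (M. Bays,
J. Kirby, *Pseudo-exponential maps, variants, and quasiminimality*, Algebra & Number Theory 12
(2018), Prop. 11.2 / Thm 11.6 (proof) with Lemma 8.3): generic strong Γ-closedness over a Γ-closed
base gives `ℵ₀`-saturation for Γ-algebraic strong extensions — here for cross Γ-isomorphisms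
`GammaField.IsGammaIsoTw₂ σ c c'` (`GammaIsoCross.lean`) over an isomorphism `σ : K₁⁰ ≅ K₂⁰` of
the Γ-fields of Γ-closed bases `K₁ ≤ F₁`, `K₂ ≤ F₂` of TWO exponential fields, source data in
`F₁`, realisation in `F₂`:

* `IsGammaIsoTw₂.exists_append_of_forall_mem_acl`, `exists_absorb_tw₂` — iterated algebraic steps
  and the absorption of the relative algebraic closure (Lemma 3.26, Cor. 7.4);
* `corestep_of_absorb_tw₂`, `exists_case1_reduct_tw₂`, `corestep_of_case2_tw₂`, `corestep_tw₂` —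
  the induction on `ldim(B/A)` (Case 1: algebraic / logarithmic element, `GammaIsoCrossSteps.lean`;
  Case 2: normalise (`exists_relative_normalised_basis`, source side) and exit geometrically by
  GSΓC over `K₂` in `F₂`, `GammaIsoCrossGeometric.lean`; descent of strongness);
* `GammaField.isGammaIsoTw₂_saturation` — **Prop. 11.2 across two fields**: for `K₁` Γ-closed in
  the algebraically closed `F₁`, `F₂` algebraically closed with `exp` onto `F₂ˣ` and generically
  strongly Γ-closed over `K₂`, `σ` an isomorphism of base Γ-fields, `c ↦ c'` a cross Γ-isomorphism
  over `σ` with `K₁ + ℚc ◁ F₁`, `K₂ + ℚc' ◁ F₂`, and `e` in `F₁` with `δ(e/K₁ + ℚc) = 0`, there is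
  `e'` in `F₂` with `(c, e) ↦ (c', e')` a cross Γ-isomorphism over `σ`, `K₂ + ℚc' + ℚe' ◁ F₂` and
  `δ(e'/K₂ + ℚc') = 0`.

This is the engine of the cross-field form of Kirby 2010, Thm 2.1 (isomorphisms of countable
`ecl`-closed subsets of two Zilber fields extend over closures), i.e. of the `ℵ₀`-homogeneity over
countable closed subsets ACROSS two members of Zilber's class in Zilber's categoricity theorem.
All proofs are those of the one-field files verbatim with the two fields kept apart. Everything
is proved; no named fact is introduced.

## References

* M. Bays, J. Kirby, *Pseudo-exponential maps, variants, and quasiminimality*, Algebra & Number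
  Theory 12 (2018) 493–549: §3.3, Lemma 3.26, §4, Cor. 7.4, Lemma 8.3, Def. 11.1, Prop. 11.2,
  Thm 11.6.
* J. Kirby, *On quasiminimal excellent classes*, J. Symbolic Logic 75 (2010) 551–564: Thm 2.1.
-/

noncomputable section

open Set

universe u

namespace Literature.NumberTheory.Transcendental

namespace GammaField

open Literature.ModelTheory.ExponentialFields.ExponentialRing ZilberSaturationMain
  Literature.FieldTheory.Regular Literature.FieldTheory.Kummer

variable {F₁ : Type u} [Field F₁] [CharZero F₁] [Literature.ModelTheory.ExponentialFields.ExponentialRing F₁]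
variable {F₂ : Type u} [Field F₂] [CharZero F₂] [Literature.ModelTheory.ExponentialFields.ExponentialRing F₂]
variable {K₁ : Submodule ℚ F₁} {K₂ : Submodule ℚ F₂} {σ : fieldOf K₁ ≃+* fieldOf K₂} {N n : ℕ}

/-! ### Iterated algebraic steps over `σ`, across two fields -/

/-- **Extending a cross Γ-isomorphism along a tuple of algebraic elements** (Lemma 3.26 iterated,
over `σ`, two fields): if `c ↦ c'` is a cross Γ-isomorphism over `σ` between strong bases and `x̄`
(in `F₁`) is linearly independent over `K₁ + ℚc` with every `x̄ⱼ` algebraic over `Γ(K₁ + ℚc)`,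
there is `x̄'` in `F₂` with `(c, x̄) ↦ (c', x̄')` a cross Γ-isomorphism over `σ` and
`K₂ + ℚc' + ℚx̄' ◁ F₂`. [cite: BaysKirby2018ANT, Lemma 3.26, Lemma 4.8] -/
theorem IsGammaIsoTw₂.exists_append_of_forall_mem_acl [IsAlgClosed F₂] (hσ : IsEBaseIso₂ K₁ K₂ σ) :
    ∀ {s N : ℕ} {c : Fin N → F₁} {c' : Fin N → F₂} (_h : IsGammaIsoTw₂ σ c c')
      (_hs : IsStrong (K₁ ⊔ Submodule.span ℚ (range c)))
      (_hs' : IsStrong (K₂ ⊔ Submodule.span ℚ (range c'))) (x : Fin s → F₁),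
      (∀ j, x j ∈ acl (gens (K₁ ⊔ Submodule.span ℚ (range c)))) →
      LinIndepOver (K₁ ⊔ Submodule.span ℚ (range c)) x →
      ∃ x' : Fin s → F₂, IsGammaIsoTw₂ σ (Fin.append c x) (Fin.append c' x') ∧
        IsStrong (K₂ ⊔ Submodule.span ℚ (range (Fin.append c' x')))
  | 0, N, c, c', h, hs, hs', x, _, _ => by
    refine ⟨Fin.elim0, ?_, ?_⟩
    · have hx : x = Fin.elim0 := funext fun i => i.elim0
      rw [hx, Fin.append_elim0, Fin.append_elim0]
      exact h.comp (Fin.cast (Nat.add_zero N))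
    · rw [Fin.append_elim0]
      have : range (c' ∘ Fin.cast (Nat.add_zero N)) = range c' := by
        ext z
        constructor
        · rintro ⟨j, rfl⟩; exact ⟨_, rfl⟩
        · rintro ⟨j, rfl⟩; exact ⟨Fin.cast (Nat.add_zero N).symm j, by simp⟩
      rw [this]
      exact hs'
  | s + 1, N, c, c', h, hs, hs', x, hacl, hind => by
    obtain ⟨x₀', h₀, hs₀'⟩ := IsGammaIsoTw₂.exists_append_of_forall_mem_acl hσ h hs hs' (x ∘ Fin.castSucc)
      (fun j => hacl _) (fun q hq => by
        have := hind (Fin.snoc q 0) (by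
          rw [Fin.sum_univ_castSucc]
          simpa only [Fin.snoc_castSucc, Fin.snoc_last, zero_smul, add_zero, Function.comp_apply] using hq)
        funext j
        have hj := congrFun this j.castSucc
        simpa only [Fin.snoc_castSucc, Pi.zero_apply] using hj)
    have hs₀ : IsStrong (K₁ ⊔ Submodule.span ℚ (range (Fin.append c (x ∘ Fin.castSucc)))) := by
      rw [ZilberHomogeneity.range_append, Submodule.span_union, ← sup_assoc]
      exact hs.sup_span_of_forall_mem_acl _ fun j => hacl _
    have hxl : x (Fin.last s) ∈ acl (gens (K₁ ⊔ Submodule.span ℚ (range (Fin.append c (x ∘ Fin.castSucc))))) :=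
      acl_mono (gens_mono (by
        rw [ZilberHomogeneity.range_append, Submodule.span_union, ← sup_assoc]; exact le_sup_left)) (hacl _)
    have hxlX : x (Fin.last s) ∉ K₁ ⊔ Submodule.span ℚ (range (Fin.append c (x ∘ Fin.castSucc))) := by
      rw [ZilberHomogeneity.range_append, Submodule.span_union, ← sup_assoc]
      exact hind.last_notMem
    obtain ⟨xl', hacl', hnot', hγ⟩ := h₀.exists_append_single_of_mem_acl hσ hs₀ hs₀' hxl hxlX
    refine ⟨Fin.snoc x₀' xl', ?_, ?_⟩
    · rw [append_eq_append_append_single c x, append_eq_append_append_single c']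
      simpa only [Fin.snoc_last, Fin.init_snoc, show (Fin.snoc x₀' xl' ∘ Fin.castSucc) = x₀' from
        funext fun i => Fin.snoc_castSucc (α := fun _ => F₂) _ _ i] using hγ
    · rw [append_eq_append_append_single c', sup_span_range_append_single]
      simp only [Fin.snoc_last, show (Fin.snoc x₀' xl' ∘ Fin.castSucc) = x₀' from
        funext fun i => Fin.snoc_castSucc (α := fun _ => F₂) _ _ i]
      exact isStrong_sup_span_singleton_of_mem_acl hs₀' hacl' hnot'

/-! ### The absorption over `σ`, across two fields -/

/-- **Absorbing the relative algebraic closure, over `σ`, two fields** (two-field form of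
`exists_absorb_tw`). Let `c ↦ c'` be a cross Γ-isomorphism over `σ` (an isomorphism of base
Γ-fields) between strong bases, `u` a basis (in `F₁`, linearly independent over `A = K₁ + ℚc`) of a
Γ-algebraic extension (`td(u/A) = n`) such that every element of `B = A + ℚu` algebraic over `Γ(A)`
lies in `A`. Then there are `x̄` in `F₁`, algebraic over `Γ(A)` and linearly independent over `B`,
and `x̄'` in `F₂` with: `(c, x̄) ↦ (c', x̄')` a cross Γ-isomorphism over `σ`; `K₁ + ℚc + ℚx̄ ◁ F₁` and
`K₂ + ℚc' + ℚx̄' ◁ F₂`; `u` linearly independent over `K₁ + ℚc + ℚx̄` with `td(u/K₁ + ℚc + ℚx̄) = n`;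
and `⟨K₁ c x̄⟩` relatively algebraically closed in `⟨K₁ c x̄⟩(u, exp u)`.
[cite: BaysKirby2018ANT, Lemma 8.3 (proof: "we may assume `A^full ∧ B = A`"), Cor. 7.4, Prop. 11.2] -/
theorem exists_absorb_tw₂ [IsAlgClosed F₁] [IsAlgClosed F₂] {N : ℕ} {c : Fin N → F₁} {c' : Fin N → F₂}
    (hiso : IsGammaIsoTw₂ σ c c') (hσ : IsEBaseIso₂ K₁ K₂ σ)
    (hs : IsStrong (K₁ ⊔ Submodule.span ℚ (range c)))
    (hs' : IsStrong (K₂ ⊔ Submodule.span ℚ (range c'))) {u : Fin n → F₁}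
    (hu : LinIndepOver (K₁ ⊔ Submodule.span ℚ (range c)) u)
    (htd : td (K₁ ⊔ Submodule.span ℚ (range c)) (Submodule.span ℚ (range u)) = n)
    (hcase : ∀ z ∈ (K₁ ⊔ Submodule.span ℚ (range c)) ⊔ Submodule.span ℚ (range u),
      z ∈ acl (gens (K₁ ⊔ Submodule.span ℚ (range c))) → z ∈ K₁ ⊔ Submodule.span ℚ (range c)) :
    ∃ (s : ℕ) (x : Fin s → F₁) (x' : Fin s → F₂),
      IsGammaIsoTw₂ σ (Fin.append c x) (Fin.append c' x') ∧
      (∀ j, x j ∈ acl (gens (K₁ ⊔ Submodule.span ℚ (range c)))) ∧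
      LinIndepOver ((K₁ ⊔ Submodule.span ℚ (range c)) ⊔ Submodule.span ℚ (range u)) x ∧
      IsStrong (K₁ ⊔ Submodule.span ℚ (range (Fin.append c x))) ∧
      IsStrong (K₂ ⊔ Submodule.span ℚ (range (Fin.append c' x'))) ∧
      LinIndepOver (K₁ ⊔ Submodule.span ℚ (range (Fin.append c x))) u ∧
      td (K₁ ⊔ Submodule.span ℚ (range (Fin.append c x))) (Submodule.span ℚ (range u)) = n ∧
      ∀ z ∈ IntermediateField.adjoin (fieldOf K₁) (allGens (Fin.append c x) ∪ range (gammaPt u)),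
        IsAlgebraic (bfld K₁ (Fin.append c x)) z → z ∈ bfld K₁ (Fin.append c x) := by
  classical
  have hfg : (IntermediateField.adjoin (bfld K₁ c) (range (gammaPt u))).FG :=
    ⟨Finset.univ.image (gammaPt u), by rw [Finset.coe_image, Finset.coe_univ, image_univ]⟩
  obtain ⟨s₀, hs₀Ω, hs₀alg, hclos⟩ := exists_finset_isAlgClosedIn_of_fg _ hfg
  set y : Fin s₀.card → F₁ := fun i => (s₀.equivFin.symm i : F₁) with hy
  have hys₀ : ∀ i, y i ∈ s₀ := fun i => (s₀.equivFin.symm i).2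
  obtain ⟨s, ρ, hxind, hspan⟩ := exists_linIndepOver_comp
    ((K₁ ⊔ Submodule.span ℚ (range c)) ⊔ Submodule.span ℚ (range u)) y
  have hxalg : ∀ j, IsAlgebraic (bfld K₁ c) ((y ∘ ρ) j) := fun j => hs₀alg _ (hys₀ _)
  have hxacl : ∀ j, (y ∘ ρ) j ∈ acl (gens (K₁ ⊔ Submodule.span ℚ (range c))) := fun j =>
    acl_subset_acl_of_subset (coe_bfld_subset_acl K₁ c) (mem_acl_coe_of_isAlgebraic _ (hxalg j))
  have hxA : LinIndepOver (K₁ ⊔ Submodule.span ℚ (range c)) (y ∘ ρ) := hxind.of_le le_sup_left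
  obtain ⟨x', hγ, hstrong'⟩ := hiso.exists_append_of_forall_mem_acl hσ hs hs' (y ∘ ρ) hxacl hxA
  have hrange : K₁ ⊔ Submodule.span ℚ (range (Fin.append c (y ∘ ρ))) =
      (K₁ ⊔ Submodule.span ℚ (range c)) ⊔ Submodule.span ℚ (range (y ∘ ρ)) := by
    rw [ZilberHomogeneity.range_append, Submodule.span_union, ← sup_assoc]
  have hstrong : IsStrong (K₁ ⊔ Submodule.span ℚ (range (Fin.append c (y ∘ ρ)))) := by
    rw [hrange]; exact hs.sup_span_of_forall_mem_acl _ hxacl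
  have hu₂ : LinIndepOver (K₁ ⊔ Submodule.span ℚ (range (Fin.append c (y ∘ ρ)))) u := by
    rw [hrange]; exact hu.sup_span_of_linIndepOver_sup hxind
  have hfgu : IsFG (K₁ ⊔ Submodule.span ℚ (range c)) (Submodule.span ℚ (range u)) :=
    isFG_span_of_finite _ (finite_range u)
  have hδu : predim (K₁ ⊔ Submodule.span ℚ (range c)) (Submodule.span ℚ (range u)) = 0 := by
    rw [predim, htd, ldim_span_eq_of_linIndepOver hu]; simp
  have hB : IsStrong ((K₁ ⊔ Submodule.span ℚ (range c)) ⊔ Submodule.span ℚ (range u)) :=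
    hs.of_predim_eq_zero le_sup_left (isFG_sup_left.2 hfgu) (by rwa [predim_sup_left])
  have hδxA : predim (K₁ ⊔ Submodule.span ℚ (range c)) (Submodule.span ℚ (range (y ∘ ρ))) = 0 := by
    refine le_antisymm (predim_span_chain_nonpos _ _ fun j => ?_)
      (isStrong_iff.1 hs _ (isFG_span_of_finite _ (finite_range _)))
    exact td_span_singleton_le_one_of_mem_acl (acl_mono (gens_mono le_sup_left) (hxacl j))
  have hδxB : predim ((K₁ ⊔ Submodule.span ℚ (range c)) ⊔ Submodule.span ℚ (range u))
      (Submodule.span ℚ (range (y ∘ ρ))) = 0 := by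
    refine le_antisymm (predim_span_chain_nonpos _ _ fun j => ?_)
      (isStrong_iff.1 hB _ (isFG_span_of_finite _ (finite_range _)))
    exact td_span_singleton_le_one_of_mem_acl
      (acl_mono (gens_mono (le_sup_left.trans le_sup_left)) (hxacl j))
  have htd₂ : td (K₁ ⊔ Submodule.span ℚ (range (Fin.append c (y ∘ ρ)))) (Submodule.span ℚ (range u)) = n := by
    rw [hrange]
    have hfg1 : IsFG (K₁ ⊔ Submodule.span ℚ (range c))
        ((K₁ ⊔ Submodule.span ℚ (range c)) ⊔ Submodule.span ℚ (range (y ∘ ρ)) ⊔ Submodule.span ℚ (range u)) := by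
      rw [sup_assoc]
      exact isFG_sup_left.2 ((isFG_span_of_finite _ (finite_range _)).sup hfgu)
    have hswap : (K₁ ⊔ Submodule.span ℚ (range c)) ⊔ Submodule.span ℚ (range (y ∘ ρ)) ⊔ Submodule.span ℚ (range u) =
        (K₁ ⊔ Submodule.span ℚ (range c)) ⊔ Submodule.span ℚ (range u) ⊔ Submodule.span ℚ (range (y ∘ ρ)) := by
      simp only [sup_assoc]
      rw [sup_comm (Submodule.span ℚ (range (y ∘ ρ)))]
    have e1 := predim_add (le_sup_left : K₁ ⊔ Submodule.span ℚ (range c) ≤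
        (K₁ ⊔ Submodule.span ℚ (range c)) ⊔ Submodule.span ℚ (range (y ∘ ρ)))
      (le_sup_left : (K₁ ⊔ Submodule.span ℚ (range c)) ⊔ Submodule.span ℚ (range (y ∘ ρ)) ≤
        (K₁ ⊔ Submodule.span ℚ (range c)) ⊔ Submodule.span ℚ (range (y ∘ ρ)) ⊔ Submodule.span ℚ (range u)) hfg1
    have e2 := predim_add (le_sup_left : K₁ ⊔ Submodule.span ℚ (range c) ≤
        (K₁ ⊔ Submodule.span ℚ (range c)) ⊔ Submodule.span ℚ (range u))
      (le_sup_left : (K₁ ⊔ Submodule.span ℚ (range c)) ⊔ Submodule.span ℚ (range u) ≤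
        (K₁ ⊔ Submodule.span ℚ (range c)) ⊔ Submodule.span ℚ (range u) ⊔ Submodule.span ℚ (range (y ∘ ρ)))
      (by rw [← hswap]; exact hfg1)
    rw [predim_sup_left, predim_sup_left, hδxA] at e1
    rw [predim_sup_left, predim_sup_left, hδu, hδxB, ← hswap] at e2
    have hδ2 : predim ((K₁ ⊔ Submodule.span ℚ (range c)) ⊔ Submodule.span ℚ (range (y ∘ ρ)))
        (Submodule.span ℚ (range u)) = 0 := by linarith
    have hld : ldim ((K₁ ⊔ Submodule.span ℚ (range c)) ⊔ Submodule.span ℚ (range (y ∘ ρ)))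
        (Submodule.span ℚ (range u)) = n := ldim_span_eq_of_linIndepOver (hrange ▸ hu₂)
    rw [predim, hld] at hδ2
    have hne : td ((K₁ ⊔ Submodule.span ℚ (range c)) ⊔ Submodule.span ℚ (range (y ∘ ρ)))
        (Submodule.span ℚ (range u)) ≠ ⊤ := td_ne_top (isFG_span_of_finite _ (finite_range u))
    rw [← ENat.coe_toNat hne]
    congr 1
    omega
  have hmemΩ₂ : ∀ z : F₁, z ∈ IntermediateField.adjoin (bfld K₁ c) (range (gammaPt u)) ↔
      z ∈ IntermediateField.adjoin (fieldOf K₁) (allGens c ∪ range (gammaPt u)) := by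
    intro z
    rw [← IntermediateField.mem_restrictScalars (fieldOf K₁), IntermediateField.adjoin_adjoin_left]
  have hAE : ∀ z ∈ K₁ ⊔ Submodule.span ℚ (range c), z ∈ bfld K₁ c := fun z hz => mem_adjoinField_of_mem_sup hz
  have hEeq : IntermediateField.adjoin (bfld K₁ c) (range (y ∘ ρ)) =
      IntermediateField.adjoin (bfld K₁ c) (↑s₀ : Set F₁) := by
    refine le_antisymm (IntermediateField.adjoin.mono _ _ _ ?_) (IntermediateField.adjoin_le_iff.2 ?_)
    · rintro _ ⟨j, rfl⟩; exact hys₀ _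
    · intro z hz
      have hzB : z ∈ (K₁ ⊔ Submodule.span ℚ (range c)) ⊔ Submodule.span ℚ (range u) ⊔
          Submodule.span ℚ (range (y ∘ ρ)) := by
        rw [hspan]
        obtain ⟨i, rfl⟩ : ∃ i, y i = z := ⟨s₀.equivFin ⟨z, hz⟩, by simp [hy]⟩
        exact Submodule.mem_sup_right (Submodule.subset_span ⟨i, rfl⟩)
      obtain ⟨β, hβ, w, hw, hsum⟩ := Submodule.mem_sup.1 hzB
      obtain ⟨r, rfl⟩ := (Submodule.mem_span_range_iff_exists_fun ℚ).1 hw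
      obtain ⟨a, ha, v, hv, hsum'⟩ := Submodule.mem_sup.1 hβ
      obtain ⟨q, rfl⟩ := (Submodule.mem_span_range_iff_exists_fun ℚ).1 hv
      have hint : IsIntegral (bfld K₁ c) (∑ i, q i • u i) := by
        have heq : ∑ i, q i • u i = z - a - ∑ i, r i • (y ∘ ρ) i := by
          rw [← hsum, ← hsum']; abel
        rw [heq]
        refine IsIntegral.sub (IsIntegral.sub (hs₀alg z hz).isIntegral ?_) ?_
        · exact (isAlgebraic_algebraMap (⟨a, hAE a ha⟩ : bfld K₁ c)).isIntegral
        · refine IsIntegral.sum _ fun i _ => ?_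
          rw [Rat.smul_def]
          have h1 : IsIntegral (bfld K₁ c) ((r i : ℚ) : F₁) := by
            have := isIntegral_algebraMap (R := bfld K₁ c) (A := F₁)
              (x := ⟨(r i : F₁), SubfieldClass.ratCast_mem _ _⟩)
            rwa [IntermediateField.algebraMap_apply] at this
          exact h1.mul (hxalg i).isIntegral
      have hqu : ∑ i, q i • u i ∈ K₁ ⊔ Submodule.span ℚ (range c) :=
        hcase _ (Submodule.mem_sup_right (Submodule.sum_mem _ fun i _ =>
          Submodule.smul_mem _ _ (Submodule.subset_span ⟨i, rfl⟩)))
          (acl_subset_acl_of_subset (coe_bfld_subset_acl K₁ c) (mem_acl_coe_of_isAlgebraic _ hint.isAlgebraic))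
      have hzeq : z = (a + ∑ i, q i • u i) + ∑ i, r i • (y ∘ ρ) i := by rw [hsum', hsum]
      rw [hzeq]
      refine add_mem ?_ (sum_mem fun i _ => ?_)
      · exact IntermediateField.algebraMap_mem _ (⟨_, hAE _ (add_mem ha hqu)⟩ : bfld K₁ c)
      · rw [Rat.smul_def]
        exact mul_mem (SubfieldClass.ratCast_mem _ _) (IntermediateField.subset_adjoin _ _ ⟨i, rfl⟩)
  have hrac₁ : ∀ z ∈ IntermediateField.adjoin (fieldOf K₁) ((allGens c ∪ range (y ∘ ρ)) ∪ range (gammaPt u)),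
      IsAlgebraic (IntermediateField.adjoin (fieldOf K₁) (allGens c ∪ range (y ∘ ρ))) z →
        z ∈ IntermediateField.adjoin (fieldOf K₁) (allGens c ∪ range (y ∘ ρ)) := by
    intro z hz halg
    have hL₁ : IntermediateField.adjoin (fieldOf K₁) (allGens c ∪ range (y ∘ ρ)) =
        (IntermediateField.adjoin (bfld K₁ c) (↑s₀ : Set F₁)).restrictScalars (fieldOf K₁) := by
      rw [← hEeq, IntermediateField.adjoin_adjoin_left]
    have hzΩ : z ∈ IntermediateField.adjoin (bfld K₁ c) (range (gammaPt u)) := by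
      rw [hmemΩ₂]
      refine (IntermediateField.adjoin_le_iff.2 ?_) hz
      refine union_subset (union_subset ?_ ?_) ?_
      · exact fun w hw => IntermediateField.subset_adjoin _ _ (Or.inl hw)
      · rintro _ ⟨j, rfl⟩; exact (hmemΩ₂ _).1 (hs₀Ω (hys₀ _))
      · exact fun w hw => IntermediateField.subset_adjoin _ _ (Or.inr hw)
    have halg' := isAlgebraic_of_intermediateField_eq hL₁ halg
    have hmem := hclos z hzΩ halg'
    rw [hL₁, IntermediateField.mem_restrictScalars]
    exact hmem
  have hrac := isAlgClosedIn_adjoinField_allGens_append (K := K₁) hB hxacl hxind hrac₁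
  exact ⟨s, y ∘ ρ, x', hγ, hxacl, hxind, hstrong, hstrong', hu₂, htd₂, hrac⟩

/-! ### Descent along the absorbed chain -/

set_option maxHeartbeats 400000 in
/-- **Descent along the absorbed chain, over `σ`, two fields** (two-field form of
`corestep_of_absorb_tw`). [cite: BaysKirby2018ANT, Lemma 8.3 (proof), Lemma 4.2] -/
theorem corestep_of_absorb_tw₂ (hσ : IsEBaseIso₂ K₁ K₂ σ) {c : Fin N → F₁} {c' : Fin N → F₂}
    (hc : LinIndepOver K₁ c) (hs : IsStrong (K₁ ⊔ Submodule.span ℚ (range c))) {u : Fin n → F₁}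
    (hu : LinIndepOver (K₁ ⊔ Submodule.span ℚ (range c)) u)
    (htd : td (K₁ ⊔ Submodule.span ℚ (range c)) (Submodule.span ℚ (range u)) = n)
    {s : ℕ} {x : Fin s → F₁} {x' : Fin s → F₂}
    (hxacl : ∀ j, x j ∈ acl (gens (K₁ ⊔ Submodule.span ℚ (range c))))
    (hxind : LinIndepOver ((K₁ ⊔ Submodule.span ℚ (range c)) ⊔ Submodule.span ℚ (range u)) x)
    {m : ℕ} {T : Fin m → F₁} {T' : Fin m → F₂} (H : IsGammaIsoTw₂ σ T T')
    (hcT : ∀ i, Fin.append c x i ∈ K₁ ⊔ Submodule.span ℚ (range T))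
    (huT : ∀ j, u j ∈ K₁ ⊔ Submodule.span ℚ (range T))
    (hTc : ∀ i, H.transport (Fin.append c x i) = Fin.append c' x' i)
    (hstrong : IsStrong (K₂ ⊔ Submodule.span ℚ (range fun j => H.transport (Fin.append (Fin.append c x) u j)))) :
    ∃ (m : ℕ) (T : Fin m → F₁) (T' : Fin m → F₂) (H : IsGammaIsoTw₂ σ T T'),
      (∀ i, c i ∈ K₁ ⊔ Submodule.span ℚ (range T)) ∧ (∀ j, u j ∈ K₁ ⊔ Submodule.span ℚ (range T)) ∧
      (∀ i, H.transport (c i) = c' i) ∧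
      IsStrong (K₂ ⊔ Submodule.span ℚ (range fun j => H.transport (Fin.append c u j))) := by
  classical
  have hcT' : ∀ i, c i ∈ K₁ ⊔ Submodule.span ℚ (range T) := fun i => by
    simpa only [Fin.append_left] using hcT (Fin.castAdd s i)
  have hxT : ∀ j, x j ∈ K₁ ⊔ Submodule.span ℚ (range T) := fun j => by
    simpa only [Fin.append_right] using hcT (Fin.natAdd N j)
  refine ⟨m, T, T', H, hcT', huT, fun i => ?_, ?_⟩
  · have := hTc (Fin.castAdd s i)
    simpa only [Fin.append_left] using this
  have hcu : ∀ j, Fin.append c u j ∈ K₁ ⊔ Submodule.span ℚ (range T) := by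
    intro j; refine Fin.addCases (fun i => ?_) (fun i => ?_) j
    · simpa only [Fin.append_left] using hcT' i
    · simpa only [Fin.append_right] using huT i
  have hB : IsStrong ((K₁ ⊔ Submodule.span ℚ (range c)) ⊔ Submodule.span ℚ (range u)) := by
    have hfgu : IsFG (K₁ ⊔ Submodule.span ℚ (range c)) (Submodule.span ℚ (range u)) :=
      isFG_span_of_finite _ (finite_range u)
    refine hs.of_predim_eq_zero le_sup_left (isFG_sup_left.2 hfgu) ?_
    rw [predim_sup_left, predim, htd, ldim_span_eq_of_linIndepOver hu]; simp
  have hBeq : K₁ ⊔ Submodule.span ℚ (range (Fin.append c u)) =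
      (K₁ ⊔ Submodule.span ℚ (range c)) ⊔ Submodule.span ℚ (range u) := by
    rw [ZilberHomogeneity.range_append, Submodule.span_union, ← sup_assoc]
  have hΛX : (K₂ ⊔ Submodule.span ℚ (range fun j => H.transport (Fin.append c u j))) ⊔
      Submodule.span ℚ (range fun j => H.transport (x j)) =
      K₂ ⊔ Submodule.span ℚ (range fun j => H.transport (Fin.append (Fin.append c x) u j)) := by
    have h1 := H.sup_span_transport_comp_eq hσ (y := Fin.append (Fin.append c x) u)
      (y' := Fin.append (Fin.append c u) x) (fun j => ?_) (fun j => ?_) ?_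
    · rw [h1]
      have h2 : (fun i => H.transport (Fin.append (Fin.append c u) x i)) =
          Fin.append (fun j => H.transport (Fin.append c u j)) (fun j => H.transport (x j)) :=
        transport_append_eq _ _ _
      rw [h2, ZilberHomogeneity.range_append, Submodule.span_union, ← sup_assoc]
    · refine Fin.addCases (fun i => ?_) (fun i => ?_) j
      · simpa only [Fin.append_left] using hcT i
      · simpa only [Fin.append_right] using huT i
    · refine Fin.addCases (fun i => ?_) (fun i => ?_) j
      · simpa only [Fin.append_left] using hcu i
      · simpa only [Fin.append_right] using hxT i
    · simp only [ZilberHomogeneity.range_append, Submodule.span_union]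
      ac_rfl
  have hindcu : LinIndepOver K₁ (Fin.append c u) := hc.append hu
  have hindall : LinIndepOver K₁ (Fin.append (Fin.append c u) x) := hindcu.append (by rwa [hBeq])
  have hisoall : IsGammaIsoTw₂ σ (Fin.append (Fin.append c u) x)
      (Fin.append (fun j => H.transport (Fin.append c u j)) (fun j => H.transport (x j))) := by
    have := H.transfer hσ (y := Fin.append (Fin.append c u) x) (fun j => by
      refine Fin.addCases (fun i => ?_) (fun i => ?_) j
      · simpa only [Fin.append_left] using hcu i
      · simpa only [Fin.append_right] using hxT i)
    rwa [transport_append_eq] at this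
  have h0 : 0 ≤ predim (K₂ ⊔ Submodule.span ℚ (range fun j => H.transport (Fin.append c u j)))
      (Submodule.span ℚ (range fun j => H.transport (x j))) := by
    rw [hisoall.predim_sup_span_eq hσ hindall, hBeq]
    exact isStrong_iff.1 hB _ (isFG_span_of_finite _ (finite_range x))
  have hchain : ∀ j : Fin s, td ((K₂ ⊔ Submodule.span ℚ (range fun j => H.transport (Fin.append c u j))) ⊔
      Submodule.span ℚ (range ((fun j => H.transport (x j)) ∘ Fin.castLE j.is_lt.le)))
      (Submodule.span ℚ {H.transport (x j)}) ≤ 1 := by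
    intro j
    have hsrc : td (((K₁ ⊔ Submodule.span ℚ (range c)) ⊔ Submodule.span ℚ (range u)) ⊔
        Submodule.span ℚ (range (x ∘ Fin.castLE j.is_lt.le))) (Submodule.span ℚ {x j}) ≤ 1 :=
      td_span_singleton_le_one_of_mem_acl
        (acl_mono (gens_mono (le_sup_left.trans le_sup_left)) (hxacl j))
    have hisoj : IsGammaIsoTw₂ σ (Fin.append (Fin.append (Fin.append c u) (x ∘ Fin.castLE j.is_lt.le)) ![x j])
        (Fin.append (Fin.append (fun k => H.transport (Fin.append c u k))
          (fun k => H.transport ((x ∘ Fin.castLE j.is_lt.le) k))) ![H.transport (x j)]) := by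
      have := H.transfer hσ (y := Fin.append (Fin.append (Fin.append c u) (x ∘ Fin.castLE j.is_lt.le)) ![x j])
        (fun k => by
          refine Fin.addCases (fun i => ?_) (fun i => ?_) k
          · rw [Fin.append_left]
            refine Fin.addCases (fun i' => ?_) (fun i' => ?_) i
            · simpa only [Fin.append_left] using hcu i'
            · simpa only [Fin.append_right, Function.comp_apply] using hxT _
          · rw [Fin.append_right]
            fin_cases i
            simpa using hxT j)
      rw [transport_append_eq, transport_append_eq] at this
      convert this using 2
      funext i
      fin_cases i
      rfl
    have ht := hisoj.td_sup_span_eq hσ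
    rw [ZilberHomogeneity.range_single, ZilberHomogeneity.range_single, ZilberHomogeneity.range_append,
      Submodule.span_union, ← sup_assoc, hBeq, ZilberHomogeneity.range_append, Submodule.span_union,
      ← sup_assoc] at ht
    have hfun : ((fun j => H.transport (x j)) ∘ Fin.castLE j.is_lt.le) =
        fun k => H.transport ((x ∘ Fin.castLE j.is_lt.le) k) := rfl
    rw [hfun, ← ht]
    exact hsrc
  have hS : IsStrong ((K₂ ⊔ Submodule.span ℚ (range fun j => H.transport (Fin.append c u j))) ⊔
      Submodule.span ℚ (range fun j => H.transport (x j))) := by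
    rw [hΛX]; exact hstrong
  exact IsStrong.of_sup_span_chain hS hchain h0

/-! ### Case 1: an algebraic or logarithmic element of `B ∖ A` -/

/-- **Case 1 of the induction, over `σ`, two fields** (two-field form of `exists_case1_reduct_tw`).
[cite: BaysKirby2018ANT, Lemma 3.26, Prop. 3.22, Lemma 4.8, Lemma 8.3 (proof)] -/
theorem exists_case1_reduct_tw₂ [IsAlgClosed F₁] [IsAlgClosed F₂] (hK : IsGammaClosed K₁)
    (hsurj : IsSurjectiveOntoUnits F₂) (hσ : IsEBaseIso₂ K₁ K₂ σ) {c : Fin N → F₁} {c' : Fin N → F₂}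
    (hiso : IsGammaIsoTw₂ σ c c') (hc : LinIndepOver K₁ c)
    (hs : IsStrong (K₁ ⊔ Submodule.span ℚ (range c)))
    (hs' : IsStrong (K₂ ⊔ Submodule.span ℚ (range c'))) {u : Fin n → F₁}
    (hu : LinIndepOver (K₁ ⊔ Submodule.span ℚ (range c)) u)
    (htd : td (K₁ ⊔ Submodule.span ℚ (range c)) (Submodule.span ℚ (range u)) = n) {x : F₁}
    (hxB : x ∈ (K₁ ⊔ Submodule.span ℚ (range c)) ⊔ Submodule.span ℚ (range u))
    (hxA : x ∉ K₁ ⊔ Submodule.span ℚ (range c))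
    (hx : x ∈ acl (gens (K₁ ⊔ Submodule.span ℚ (range c))) ∨
      exp x ∈ acl (gens (K₁ ⊔ Submodule.span ℚ (range c)))) :
    ∃ (x' : F₂) (n₁ : ℕ) (u₁ : Fin n₁ → F₁), n₁ < n ∧
      IsGammaIsoTw₂ σ (Fin.append c ![x]) (Fin.append c' ![x']) ∧
      LinIndepOver K₁ (Fin.append c ![x]) ∧
      IsStrong (K₁ ⊔ Submodule.span ℚ (range (Fin.append c ![x]))) ∧
      IsStrong (K₂ ⊔ Submodule.span ℚ (range (Fin.append c' ![x']))) ∧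
      LinIndepOver (K₁ ⊔ Submodule.span ℚ (range (Fin.append c ![x]))) u₁ ∧
      td (K₁ ⊔ Submodule.span ℚ (range (Fin.append c ![x]))) (Submodule.span ℚ (range u₁)) = n₁ ∧
      (∀ j, u₁ j ∈ (K₁ ⊔ Submodule.span ℚ (range c)) ⊔ Submodule.span ℚ (range u)) ∧
      (∀ j, u j ∈ (K₁ ⊔ Submodule.span ℚ (range (Fin.append c ![x]))) ⊔ Submodule.span ℚ (range u₁)) := by
  classical
  have hstep : ∃ x' : F₂, IsGammaIsoTw₂ σ (Fin.append c ![x]) (Fin.append c' ![x']) ∧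
      IsStrong (K₂ ⊔ Submodule.span ℚ (range (Fin.append c' ![x']))) := by
    rcases hx with hx | hx
    · obtain ⟨x', hx'acl, hx'A, hγ⟩ := hiso.exists_append_single_of_mem_acl hσ hs hs' hx hxA
      refine ⟨x', hγ, ?_⟩
      rw [sup_span_range_append_single]
      exact isStrong_sup_span_singleton_of_mem_acl hs' hx'acl hx'A
    · obtain ⟨x', hx'acl, hx'A, hγ⟩ := hiso.exists_append_single_of_exp_mem_acl hK hsurj hσ hc hs hs' hx hxA
      refine ⟨x', hγ, ?_⟩
      rw [sup_span_range_append_single]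
      exact isStrong_sup_span_singleton_of_exp_mem_acl hs' hx'acl hx'A
  obtain ⟨x', hγ, hs₁'⟩ := hstep
  have hA₁ : K₁ ⊔ Submodule.span ℚ (range (Fin.append c ![x])) =
      (K₁ ⊔ Submodule.span ℚ (range c)) ⊔ Submodule.span ℚ {x} := sup_span_range_append_single K₁ c x
  have htd1 : td (K₁ ⊔ Submodule.span ℚ (range c)) (Submodule.span ℚ {x}) ≤ 1 := by
    rcases hx with hx | hx
    · exact td_span_singleton_le_one_of_mem_acl hx
    · exact td_span_singleton_le_one_of_exp_mem_acl hx
  have hδx : predim (K₁ ⊔ Submodule.span ℚ (range c)) (Submodule.span ℚ {x}) = 0 :=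
    (td_eq_one_and_predim_eq_zero_of_td_le_one hs hxA htd1).2
  have hs₁ : IsStrong (K₁ ⊔ Submodule.span ℚ (range (Fin.append c ![x]))) := by
    rw [hA₁]
    exact hs.of_predim_eq_zero le_sup_left (isFG_sup_left.2 (isFG_span_of_finite _ (finite_singleton x)))
      (by rwa [predim_sup_left])
  have hc₁ : LinIndepOver K₁ (Fin.append c ![x]) := hc.append_single hxA
  obtain ⟨n₁, ρ, hu₁, hu₁span⟩ := exists_linIndepOver_comp (K₁ ⊔ Submodule.span ℚ (range (Fin.append c ![x]))) u
  have hBeq : (K₁ ⊔ Submodule.span ℚ (range (Fin.append c ![x]))) ⊔ Submodule.span ℚ (range u) =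
      (K₁ ⊔ Submodule.span ℚ (range c)) ⊔ Submodule.span ℚ (range u) := by
    rw [hA₁]
    refine le_antisymm (sup_le (sup_le le_sup_left ((Submodule.span_singleton_le_iff_mem _ _).2 hxB)) le_sup_right) ?_
    exact sup_le (le_sup_left.trans le_sup_left) le_sup_right
  have hfgu : IsFG (K₁ ⊔ Submodule.span ℚ (range c)) (Submodule.span ℚ (range u)) :=
    isFG_span_of_finite _ (finite_range u)
  have hfgB : IsFG (K₁ ⊔ Submodule.span ℚ (range c))
      ((K₁ ⊔ Submodule.span ℚ (range (Fin.append c ![x]))) ⊔ Submodule.span ℚ (range u)) := by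
    rw [hBeq]; exact isFG_sup_left.2 hfgu
  have hle₁ : K₁ ⊔ Submodule.span ℚ (range c) ≤ K₁ ⊔ Submodule.span ℚ (range (Fin.append c ![x])) := by
    rw [hA₁]; exact le_sup_left
  have hldim := ldim_add hle₁ (le_sup_left : K₁ ⊔ Submodule.span ℚ (range (Fin.append c ![x])) ≤
      (K₁ ⊔ Submodule.span ℚ (range (Fin.append c ![x]))) ⊔ Submodule.span ℚ (range u)) hfgB
  have hl1 : ldim (K₁ ⊔ Submodule.span ℚ (range c)) (K₁ ⊔ Submodule.span ℚ (range (Fin.append c ![x]))) = 1 := by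
    rw [hA₁, ldim_sup_left, ldim_span_singleton_of_not_mem hxA]
  have hl2 : ldim (K₁ ⊔ Submodule.span ℚ (range (Fin.append c ![x])))
      ((K₁ ⊔ Submodule.span ℚ (range (Fin.append c ![x]))) ⊔ Submodule.span ℚ (range u)) = n₁ := by
    rw [← hu₁span, ldim_sup_left, ldim_span_eq_of_linIndepOver hu₁]
  have hl3 : ldim (K₁ ⊔ Submodule.span ℚ (range c))
      ((K₁ ⊔ Submodule.span ℚ (range (Fin.append c ![x]))) ⊔ Submodule.span ℚ (range u)) = n := by
    rw [hBeq, ldim_sup_left, ldim_span_eq_of_linIndepOver hu]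
  rw [hl1, hl2, hl3] at hldim
  have hlt : n₁ < n := by omega
  have hδB : predim (K₁ ⊔ Submodule.span ℚ (range c))
      ((K₁ ⊔ Submodule.span ℚ (range (Fin.append c ![x]))) ⊔ Submodule.span ℚ (range u)) = 0 := by
    rw [hBeq, predim_sup_left, predim, htd, ldim_span_eq_of_linIndepOver hu]; simp
  have hpadd := predim_add hle₁ (le_sup_left : K₁ ⊔ Submodule.span ℚ (range (Fin.append c ![x])) ≤
      (K₁ ⊔ Submodule.span ℚ (range (Fin.append c ![x]))) ⊔ Submodule.span ℚ (range u)) hfgB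
  have hδ1 : predim (K₁ ⊔ Submodule.span ℚ (range c)) (K₁ ⊔ Submodule.span ℚ (range (Fin.append c ![x]))) = 0 := by
    rw [hA₁, predim_sup_left, hδx]
  rw [hδB, hδ1, zero_add] at hpadd
  have htd₁ : td (K₁ ⊔ Submodule.span ℚ (range (Fin.append c ![x]))) (Submodule.span ℚ (range (u ∘ ρ))) = n₁ := by
    have h0 : predim (K₁ ⊔ Submodule.span ℚ (range (Fin.append c ![x]))) (Submodule.span ℚ (range (u ∘ ρ))) = 0 := by
      rw [← predim_sup_left, hu₁span]
      exact hpadd.symm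
    rw [predim, ldim_span_eq_of_linIndepOver hu₁] at h0
    have hne : td (K₁ ⊔ Submodule.span ℚ (range (Fin.append c ![x]))) (Submodule.span ℚ (range (u ∘ ρ))) ≠ ⊤ :=
      td_ne_top (isFG_span_of_finite _ (finite_range _))
    rw [← ENat.coe_toNat hne]
    congr 1
    omega
  refine ⟨x', n₁, u ∘ ρ, hlt, hγ, hc₁, hs₁, hs₁', hu₁, htd₁, fun j => ?_, fun j => ?_⟩
  · exact Submodule.mem_sup_right (Submodule.subset_span ⟨ρ j, rfl⟩)
  · rw [hu₁span]
    exact Submodule.mem_sup_right (Submodule.subset_span ⟨j, rfl⟩)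

/-! ### Case 2: the geometric exit -/

set_option maxHeartbeats 400000 in
/-- **Case 2 of the induction (geometric exit), over `σ`, two fields** (two-field form of
`corestep_of_case2_tw`). [cite: BaysKirby2018ANT, Prop. 11.2, Thm 11.6 (proof)] -/
theorem corestep_of_case2_tw₂ [IsAlgClosed F₁] [IsAlgClosed F₂] (hK : IsGammaClosed K₁)
    (hG : IsGenericallyStronglyGammaClosedOver K₂) (hσ : IsEBaseIso₂ K₁ K₂ σ) {c : Fin N → F₁}
    {c' : Fin N → F₂} (hiso : IsGammaIsoTw₂ σ c c')
    (hc : LinIndepOver K₁ c) (hs : IsStrong (K₁ ⊔ Submodule.span ℚ (range c)))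
    (hs' : IsStrong (K₂ ⊔ Submodule.span ℚ (range c'))) {u : Fin n → F₁}
    (hu : LinIndepOver (K₁ ⊔ Submodule.span ℚ (range c)) u)
    (htd : td (K₁ ⊔ Submodule.span ℚ (range c)) (Submodule.span ℚ (range u)) = n)
    (hcase : ∀ z ∈ (K₁ ⊔ Submodule.span ℚ (range c)) ⊔ Submodule.span ℚ (range u),
      (z ∈ acl (gens (K₁ ⊔ Submodule.span ℚ (range c))) → z ∈ K₁ ⊔ Submodule.span ℚ (range c)) ∧
      (exp z ∈ acl (gens (K₁ ⊔ Submodule.span ℚ (range c))) → z ∈ K₁ ⊔ Submodule.span ℚ (range c)))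
    (hrac : ∀ z ∈ IntermediateField.adjoin (fieldOf K₁) (allGens c ∪ range (gammaPt u)),
      IsAlgebraic (bfld K₁ c) z → z ∈ bfld K₁ c) :
    ∃ (m : ℕ) (T : Fin m → F₁) (T' : Fin m → F₂) (H : IsGammaIsoTw₂ σ T T'),
      (∀ i, c i ∈ K₁ ⊔ Submodule.span ℚ (range T)) ∧ (∀ j, u j ∈ K₁ ⊔ Submodule.span ℚ (range T)) ∧
      (∀ i, H.transport (c i) = c' i) ∧
      IsStrong (K₂ ⊔ Submodule.span ℚ (range fun j => H.transport (Fin.append c u j))) := by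
  classical
  have hmul : ∀ w : Fin n → ℤ, exp (∑ j, (w j : ℚ) • u j) ∈
      IntermediateField.adjoin (fieldOf K₁) (allGens c) → w = 0 := by
    intro w hw
    by_contra hw0
    have hmem : ∑ j, (w j : ℚ) • u j ∈ (K₁ ⊔ Submodule.span ℚ (range c)) ⊔ Submodule.span ℚ (range u) :=
      Submodule.mem_sup_right (Submodule.sum_mem _ fun j _ =>
        Submodule.smul_mem _ _ (Submodule.subset_span ⟨j, rfl⟩))
    have hA := (hcase _ hmem).2 (coe_bfld_subset_acl K₁ c hw)
    exact hu.sum_intCast_smul_notMem hw0 hA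
  obtain ⟨ut, hutspan, hutint, hfield, hkum⟩ := exists_relative_normalised_basis hK c hmul hrac
  have hspan_eq : Submodule.span ℚ (range ut) = Submodule.span ℚ (range u) := by
    refine le_antisymm (Submodule.span_le.2 ?_) (Submodule.span_le.2 ?_)
    · rintro _ ⟨j, rfl⟩; exact hutspan j
    · rintro _ ⟨i, rfl⟩
      obtain ⟨z, hz⟩ := hutint i
      rw [hz]
      exact Submodule.sum_mem _ fun j _ => Submodule.smul_mem _ _ (Submodule.subset_span ⟨j, rfl⟩)
  have hut : LinIndepOver (K₁ ⊔ Submodule.span ℚ (range c)) ut := hu.of_sup_span_eq (by rw [hspan_eq])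
  have htdt : td (K₁ ⊔ Submodule.span ℚ (range c)) (Submodule.span ℚ (range ut)) = n := by
    rw [hspan_eq]; exact htd
  have hfree : ∀ m : Fin n → ℤ, m ≠ 0 →
      ∑ j, (m j : ℚ) • ut j ∉ acl (gens (K₁ ⊔ Submodule.span ℚ (range c))) ∧
      exp (∑ j, (m j : ℚ) • ut j) ∉ acl (gens (K₁ ⊔ Submodule.span ℚ (range c))) := by
    intro m hm
    have hmem : ∑ j, (m j : ℚ) • ut j ∈ (K₁ ⊔ Submodule.span ℚ (range c)) ⊔ Submodule.span ℚ (range u) := by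
      rw [← hspan_eq]
      exact Submodule.mem_sup_right (Submodule.sum_mem _ fun j _ =>
        Submodule.smul_mem _ _ (Submodule.subset_span ⟨j, rfl⟩))
    have hnot := hut.sum_intCast_smul_notMem hm
    exact ⟨fun h => hnot ((hcase _ hmem).1 h), fun h => hnot ((hcase _ hmem).2 h)⟩
  have hrac' : ∀ z ∈ IntermediateField.adjoin (fieldOf K₁) (allGens c ∪ range (gammaPt ut)),
      IsAlgebraic (bfld K₁ c) z → z ∈ bfld K₁ c := fun z hz halg => hrac z (hfield ▸ hz) halg
  have hc' : LinIndepOver K₂ c' := hiso.linIndepOver hσ hc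
  obtain ⟨g, hγ, hstrong'⟩ :=
    exists_isGammaIsoTw₂_append_of_gsgc hK hG hiso hc hc' hs hs' hut htdt hfree hrac' hkum
  have hcT : ∀ i, c i ∈ K₁ ⊔ Submodule.span ℚ (range (Fin.append c ut)) := fun i =>
    Submodule.mem_sup_right (Submodule.subset_span ⟨Fin.castAdd n i, by simp⟩)
  have huT : ∀ j, u j ∈ K₁ ⊔ Submodule.span ℚ (range (Fin.append c ut)) := by
    intro j
    have : u j ∈ Submodule.span ℚ (range ut) := by
      rw [hspan_eq]; exact Submodule.subset_span ⟨j, rfl⟩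
    refine Submodule.mem_sup_right (Submodule.span_mono ?_ this)
    rintro _ ⟨i, rfl⟩; exact ⟨Fin.natAdd N i, by simp⟩
  refine ⟨N + n, Fin.append c ut, Fin.append c' g, hγ, hcT, huT, fun i => ?_, ?_⟩
  · have := hγ.transport_apply (Fin.castAdd n i)
    simpa only [Fin.append_left] using this
  · have heq : K₁ ⊔ Submodule.span ℚ (range (Fin.append c u)) = K₁ ⊔ Submodule.span ℚ (range (Fin.append c ut)) := by
      rw [ZilberHomogeneity.range_append, ZilberHomogeneity.range_append, Submodule.span_union,
        Submodule.span_union, hspan_eq]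
    have hutT : ∀ j, Fin.append c ut j ∈ K₁ ⊔ Submodule.span ℚ (range (Fin.append c ut)) := fun j =>
      Submodule.mem_sup_right (Submodule.subset_span ⟨j, rfl⟩)
    have hy1 : ∀ j, Fin.append c u j ∈ K₁ ⊔ Submodule.span ℚ (range (Fin.append c ut)) := by
      intro j
      refine Fin.addCases (fun i => ?_) (fun i => ?_) j
      · simpa only [Fin.append_left] using hcT i
      · simpa only [Fin.append_right] using huT i
    rw [hγ.sup_span_transport_comp_eq hσ hy1 hutT heq]
    have : (fun j => hγ.transport (Fin.append c ut j)) = Fin.append c' g := funext fun j => hγ.transport_apply j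
    rw [this]
    exact hstrong'

/-! ### The induction -/

/-- **The core of Prop. 11.2 over `σ`, two fields** (two-field form of `corestep_tw`): induction
on the linear dimension of `B/A`. [cite: BaysKirby2018ANT, Prop. 11.2, Thm 11.6 (proof), Lemma 8.3 (proof)] -/
theorem corestep_tw₂ [IsAlgClosed F₁] [IsAlgClosed F₂] (hK : IsGammaClosed K₁)
    (hsurj : IsSurjectiveOntoUnits F₂) (hG : IsGenericallyStronglyGammaClosedOver K₂)
    (hσ : IsEBaseIso₂ K₁ K₂ σ) :
    ∀ (n : ℕ) {N : ℕ} {c : Fin N → F₁} {c' : Fin N → F₂} (_hiso : IsGammaIsoTw₂ σ c c')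
      (_hc : LinIndepOver K₁ c) (_hs : IsStrong (K₁ ⊔ Submodule.span ℚ (range c)))
      (_hs' : IsStrong (K₂ ⊔ Submodule.span ℚ (range c'))) {u : Fin n → F₁}
      (_hu : LinIndepOver (K₁ ⊔ Submodule.span ℚ (range c)) u)
      (_htd : td (K₁ ⊔ Submodule.span ℚ (range c)) (Submodule.span ℚ (range u)) = n),
      ∃ (m : ℕ) (T : Fin m → F₁) (T' : Fin m → F₂) (H : IsGammaIsoTw₂ σ T T'),
        (∀ i, c i ∈ K₁ ⊔ Submodule.span ℚ (range T)) ∧ (∀ j, u j ∈ K₁ ⊔ Submodule.span ℚ (range T)) ∧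
        (∀ i, H.transport (c i) = c' i) ∧
        IsStrong (K₂ ⊔ Submodule.span ℚ (range fun j => H.transport (Fin.append c u j))) := by
  intro n
  induction n using Nat.strong_induction_on with
  | _ n ih =>
    intro N c c' hiso hc hs hs' u hu htd
    classical
    by_cases h1 : ∃ x ∈ (K₁ ⊔ Submodule.span ℚ (range c)) ⊔ Submodule.span ℚ (range u),
        x ∉ K₁ ⊔ Submodule.span ℚ (range c) ∧
        (x ∈ acl (gens (K₁ ⊔ Submodule.span ℚ (range c))) ∨ exp x ∈ acl (gens (K₁ ⊔ Submodule.span ℚ (range c))))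
    · obtain ⟨x, hxB, hxA, hx⟩ := h1
      obtain ⟨x', n₁, u₁, hlt, hγ, hc₁, hs₁, hs₁', hu₁, htd₁, hu₁B, huB₁⟩ :=
        exists_case1_reduct_tw₂ hK hsurj hσ hiso hc hs hs' hu htd hxB hxA hx
      obtain ⟨m, T, T', H, hcT, huT, hTc, hstr⟩ := ih n₁ hlt hγ hc₁ hs₁ hs₁' hu₁ htd₁
      exact corestep_of_case1₂ hσ hu₁B huB₁ hxB H hcT huT hTc hstr
    · push Not at h1
      have hcase : ∀ z ∈ (K₁ ⊔ Submodule.span ℚ (range c)) ⊔ Submodule.span ℚ (range u),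
          (z ∈ acl (gens (K₁ ⊔ Submodule.span ℚ (range c))) → z ∈ K₁ ⊔ Submodule.span ℚ (range c)) ∧
          (exp z ∈ acl (gens (K₁ ⊔ Submodule.span ℚ (range c))) → z ∈ K₁ ⊔ Submodule.span ℚ (range c)) := by
        intro z hz
        constructor
        · intro hzacl; by_contra hzA; exact (h1 z hz hzA).1 hzacl
        · intro hzacl; by_contra hzA; exact (h1 z hz hzA).2 hzacl
      obtain ⟨s, x, x', hγ, hxacl, hxind, hs₂, hs₂', hu₂, htd₂, hrac⟩ :=
        exists_absorb_tw₂ hiso hσ hs hs' hu htd (fun z hz hzacl => (hcase z hz).1 hzacl)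
      have hc₂ : LinIndepOver K₁ (Fin.append c x) := hc.append (hxind.of_le le_sup_left)
      have hout : ∃ (m : ℕ) (T : Fin m → F₁) (T' : Fin m → F₂) (H : IsGammaIsoTw₂ σ T T'),
          (∀ i, Fin.append c x i ∈ K₁ ⊔ Submodule.span ℚ (range T)) ∧
          (∀ j, u j ∈ K₁ ⊔ Submodule.span ℚ (range T)) ∧
          (∀ i, H.transport (Fin.append c x i) = Fin.append c' x' i) ∧
          IsStrong (K₂ ⊔ Submodule.span ℚ (range fun j => H.transport (Fin.append (Fin.append c x) u j))) := by
        by_cases h2 : ∃ y ∈ (K₁ ⊔ Submodule.span ℚ (range (Fin.append c x))) ⊔ Submodule.span ℚ (range u),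
            y ∉ K₁ ⊔ Submodule.span ℚ (range (Fin.append c x)) ∧
            (y ∈ acl (gens (K₁ ⊔ Submodule.span ℚ (range (Fin.append c x)))) ∨
              exp y ∈ acl (gens (K₁ ⊔ Submodule.span ℚ (range (Fin.append c x)))))
        · obtain ⟨y, hyB, hyA, hy⟩ := h2
          obtain ⟨y', n₁, u₁, hlt, hγ₁, hc₁, hs₁, hs₁', hu₁, htd₁, hu₁B, huB₁⟩ :=
            exists_case1_reduct_tw₂ hK hsurj hσ hγ hc₂ hs₂ hs₂' hu₂ htd₂ hyB hyA hy
          obtain ⟨m, T, T', H, hcT, huT, hTc, hstr⟩ := ih n₁ hlt hγ₁ hc₁ hs₁ hs₁' hu₁ htd₁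
          exact corestep_of_case1₂ hσ hu₁B huB₁ hyB H hcT huT hTc hstr
        · push Not at h2
          have hcase₂ : ∀ z ∈ (K₁ ⊔ Submodule.span ℚ (range (Fin.append c x))) ⊔ Submodule.span ℚ (range u),
              (z ∈ acl (gens (K₁ ⊔ Submodule.span ℚ (range (Fin.append c x)))) →
                z ∈ K₁ ⊔ Submodule.span ℚ (range (Fin.append c x))) ∧
              (exp z ∈ acl (gens (K₁ ⊔ Submodule.span ℚ (range (Fin.append c x)))) →
                z ∈ K₁ ⊔ Submodule.span ℚ (range (Fin.append c x))) := by
            intro z hz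
            constructor
            · intro hzacl; by_contra hzA; exact (h2 z hz hzA).1 hzacl
            · intro hzacl; by_contra hzA; exact (h2 z hz hzA).2 hzacl
          exact corestep_of_case2_tw₂ hK hG hσ hγ hc₂ hs₂ hs₂' hu₂ htd₂ hcase₂ hrac
      obtain ⟨m, T, T', H, hcT, huT, hTc, hstr⟩ := hout
      exact corestep_of_absorb_tw₂ hσ hc hs hu htd hxacl hxind H hcT huT hTc hstr

/-! ### Prop. 11.2 across two fields -/

/-- **Bays–Kirby 2018, Prop. 11.2 over an isomorphism of Γ-closed bases, across two fields** (the
cross-field `ℵ₀`-saturation needed for Kirby 2010, Thm 2.1 between two Zilber fields). Let `K₁` be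
Γ-closed in the algebraically closed `F₁`, `F₂` algebraically closed with `exp` onto `F₂ˣ` and
generically strongly Γ-closed over `K₂`, and `σ : K₁⁰ ≃ K₂⁰` an isomorphism of the base Γ-fields
(`IsEBaseIso₂`). If `c ↦ c'` is a cross Γ-isomorphism over `σ` with `K₁ + ℚc ◁ F₁`,
`K₂ + ℚc' ◁ F₂`, and `e` is a tuple of `F₁` with `δ(e/K₁ + ℚc) = 0` (a Γ-algebraic extension),
then there is `e'` in `F₂` with `(c, e) ↦ (c', e')` a cross Γ-isomorphism over `σ`,
`K₂ + ℚc' + ℚe' ◁ F₂`, and `δ(e'/K₂ + ℚc') = 0`. Proof: extract bases, run `corestep_tw₂`,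
transport `e` along the resulting cross Γ-isomorphism.
[cite: BaysKirby2018ANT, Prop. 11.2] [cite: Kirby2010QMEC, Thm 2.1] -/
theorem isGammaIsoTw₂_saturation [IsAlgClosed F₁] [IsAlgClosed F₂] (hsurj : IsSurjectiveOntoUnits F₂)
    (hK : IsGammaClosed K₁) (hG : IsGenericallyStronglyGammaClosedOver K₂) (hσ : IsEBaseIso₂ K₁ K₂ σ)
    {N k : ℕ} {c : Fin N → F₁} {c' : Fin N → F₂} {e : Fin k → F₁}
    (hs : IsStrong (K₁ ⊔ Submodule.span ℚ (range c)))
    (hs' : IsStrong (K₂ ⊔ Submodule.span ℚ (range c'))) (hiso : IsGammaIsoTw₂ σ c c')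
    (hδ : predim (K₁ ⊔ Submodule.span ℚ (range c)) (Submodule.span ℚ (range e)) = 0) :
    ∃ e' : Fin k → F₂, IsGammaIsoTw₂ σ (Fin.append c e) (Fin.append c' e') ∧
      IsStrong (K₂ ⊔ Submodule.span ℚ (range (Fin.append c' e'))) ∧
      predim (K₂ ⊔ Submodule.span ℚ (range c')) (Submodule.span ℚ (range e')) = 0 := by
  classical
  obtain ⟨N₀, ρ, hc₀, hA⟩ := exists_linIndepOver_comp K₁ c
  have hiso₀ : IsGammaIsoTw₂ σ (c ∘ ρ) (c' ∘ ρ) := hiso.comp ρ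
  have hs₀ : IsStrong (K₁ ⊔ Submodule.span ℚ (range (c ∘ ρ))) := by rw [hA]; exact hs
  have hA' : K₂ ⊔ Submodule.span ℚ (range (c' ∘ ρ)) = K₂ ⊔ Submodule.span ℚ (range c') := by
    have h1 := hiso.sup_span_transport_eq hσ (y := c ∘ ρ)
      (fun j => Submodule.mem_sup_right (Submodule.subset_span ⟨ρ j, rfl⟩))
      (fun i => by rw [hA]; exact Submodule.mem_sup_right (Submodule.subset_span ⟨i, rfl⟩))
    have heq : (fun j => hiso.transport ((c ∘ ρ) j)) = c' ∘ ρ := funext fun j => hiso.transport_apply _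
    rwa [heq] at h1
  have hs₀' : IsStrong (K₂ ⊔ Submodule.span ℚ (range (c' ∘ ρ))) := by rw [hA']; exact hs'
  obtain ⟨n, τ, hu, hB⟩ := exists_linIndepOver_comp (K₁ ⊔ Submodule.span ℚ (range (c ∘ ρ))) e
  have htd : td (K₁ ⊔ Submodule.span ℚ (range (c ∘ ρ))) (Submodule.span ℚ (range (e ∘ τ))) = n := by
    have hl : ldim (K₁ ⊔ Submodule.span ℚ (range (c ∘ ρ))) (Submodule.span ℚ (range (e ∘ τ))) = n :=
      ldim_span_eq_of_linIndepOver hu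
    have hl' : ldim (K₁ ⊔ Submodule.span ℚ (range (c ∘ ρ))) (Submodule.span ℚ (range e)) = n := by
      rw [← ldim_sup_left, ← hB, ldim_sup_left, hl]
    have ht : td (K₁ ⊔ Submodule.span ℚ (range (c ∘ ρ))) (Submodule.span ℚ (range (e ∘ τ))) =
        td (K₁ ⊔ Submodule.span ℚ (range (c ∘ ρ))) (Submodule.span ℚ (range e)) := by
      rw [← td_sup_left, hB, td_sup_left]
    have h0 : predim (K₁ ⊔ Submodule.span ℚ (range (c ∘ ρ))) (Submodule.span ℚ (range e)) = 0 := by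
      rw [hA]; exact hδ
    rw [predim, hl'] at h0
    rw [ht]
    have hne : td (K₁ ⊔ Submodule.span ℚ (range (c ∘ ρ))) (Submodule.span ℚ (range e)) ≠ ⊤ :=
      td_ne_top (isFG_span_of_finite _ (finite_range e))
    rw [← ENat.coe_toNat hne]
    congr 1
    omega
  obtain ⟨m, T, T', H, hcT, huT, hTc, hstrong⟩ := corestep_tw₂ hK hsurj hG hσ n hiso₀ hc₀ hs₀ hs₀' hu htd
  have hA_le : K₁ ⊔ Submodule.span ℚ (range c) ≤ K₁ ⊔ Submodule.span ℚ (range T) := by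
    rw [← hA]
    refine sup_le le_sup_left (Submodule.span_le.2 ?_)
    rintro _ ⟨j, rfl⟩; exact hcT j
  have hcT' : ∀ i, c i ∈ K₁ ⊔ Submodule.span ℚ (range T) := fun i =>
    hA_le (Submodule.mem_sup_right (Submodule.subset_span ⟨i, rfl⟩))
  have hle' : (K₁ ⊔ Submodule.span ℚ (range (c ∘ ρ))) ⊔ Submodule.span ℚ (range (e ∘ τ)) ≤
      K₁ ⊔ Submodule.span ℚ (range T) := by
    refine sup_le (hA.le.trans hA_le) (Submodule.span_le.2 ?_)
    rintro _ ⟨i, rfl⟩; exact huT i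
  have heT : ∀ j, e j ∈ K₁ ⊔ Submodule.span ℚ (range T) := by
    intro j
    have : e j ∈ (K₁ ⊔ Submodule.span ℚ (range (c ∘ ρ))) ⊔ Submodule.span ℚ (range e) :=
      Submodule.mem_sup_right (Submodule.subset_span ⟨j, rfl⟩)
    rw [← hB] at this
    exact hle' this
  have hTc' : ∀ i, H.transport (c i) = c' i := by
    intro i
    have hci : c i ∈ K₁ ⊔ Submodule.span ℚ (range (c ∘ ρ)) := by
      rw [hA]; exact Submodule.mem_sup_right (Submodule.subset_span ⟨i, rfl⟩)
    have h1 : hiso₀.transport (c i) = H.transport (c i) :=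
      hiso₀.transport_eq_transport H hcT hTc hci
    have h2 : hiso₀.transport (c i) = hiso.transport (c i) :=
      hiso₀.transport_eq_transport hiso
        (fun j => Submodule.mem_sup_right (Submodule.subset_span ⟨ρ j, rfl⟩))
        (fun j => hiso.transport_apply _) hci
    rw [← h1, h2, hiso.transport_apply]
  have hy1 : ∀ j, Fin.append c e j ∈ K₁ ⊔ Submodule.span ℚ (range T) := by
    intro j
    refine Fin.addCases (fun i => ?_) (fun i => ?_) j
    · simpa only [Fin.append_left] using hcT' i
    · simpa only [Fin.append_right] using heT i
  have hy2 : ∀ j, Fin.append (c ∘ ρ) (e ∘ τ) j ∈ K₁ ⊔ Submodule.span ℚ (range T) := by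
    intro j
    refine Fin.addCases (fun i => ?_) (fun i => ?_) j
    · simpa only [Fin.append_left] using hcT i
    · simpa only [Fin.append_right] using huT i
  have h1 : Fin.append c' (fun j => H.transport (e j)) = fun j => H.transport (Fin.append c e j) := by
    rw [transport_append_eq]
    congr 1
    exact (funext hTc').symm
  have heq : K₁ ⊔ Submodule.span ℚ (range (Fin.append c e)) =
      K₁ ⊔ Submodule.span ℚ (range (Fin.append (c ∘ ρ) (e ∘ τ))) := by
    rw [ZilberHomogeneity.range_append, ZilberHomogeneity.range_append, Submodule.span_union,
      Submodule.span_union, ← sup_assoc, ← sup_assoc, ← hA, hB, hA]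
  have hspan' := H.sup_span_transport_comp_eq hσ hy1 hy2 heq
  refine ⟨fun j => H.transport (e j), ?_, ?_, ?_⟩
  · have := H.transfer hσ (y := Fin.append c e) hy1
    rw [transport_append_eq] at this
    have heq' : (fun i => H.transport (c i)) = c' := funext hTc'
    rwa [heq'] at this
  · rw [h1, hspan']
    exact hstrong
  · -- `δ(e'/K₂ + ℚc') = 0`: transfer along the independent sub-tuples
    have h3 := H.transfer hσ (y := Fin.append (c ∘ ρ) (e ∘ τ)) hy2
    rw [transport_append_eq] at h3
    have hcρ : (fun i => H.transport ((c ∘ ρ) i)) = c' ∘ ρ := funext fun i => hTc i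
    rw [hcρ] at h3
    have hind : LinIndepOver K₁ (Fin.append (c ∘ ρ) (e ∘ τ)) := hc₀.append hu
    have hp := h3.predim_sup_span_eq hσ hind
    have hsrc : predim (K₁ ⊔ Submodule.span ℚ (range (c ∘ ρ))) (Submodule.span ℚ (range (e ∘ τ))) = 0 := by
      rw [predim, htd, ldim_span_eq_of_linIndepOver hu]; simp
    rw [hsrc, hA'] at hp
    -- the two target spans agree
    have hsup : (K₂ ⊔ Submodule.span ℚ (range c')) ⊔ Submodule.span ℚ (range fun j => H.transport (e j)) =
        (K₂ ⊔ Submodule.span ℚ (range c')) ⊔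
          Submodule.span ℚ (range fun i => H.transport ((e ∘ τ) i)) := by
      have e1 : (K₂ ⊔ Submodule.span ℚ (range c')) ⊔ Submodule.span ℚ (range fun j => H.transport (e j)) =
          K₂ ⊔ Submodule.span ℚ (range fun j => H.transport (Fin.append c e j)) := by
        rw [← h1, ZilberHomogeneity.range_append, Submodule.span_union, ← sup_assoc]
      have e2 : K₂ ⊔ Submodule.span ℚ (range fun j => H.transport (Fin.append (c ∘ ρ) (e ∘ τ) j)) =
          (K₂ ⊔ Submodule.span ℚ (range (c' ∘ ρ))) ⊔ Submodule.span ℚ (range fun i => H.transport ((e ∘ τ) i)) := by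
        rw [transport_append_eq, hcρ, ZilberHomogeneity.range_append, Submodule.span_union, ← sup_assoc]
      rw [e1, hspan', e2, hA']
    rw [← predim_sup_left, hsup, predim_sup_left]
    exact hp

end GammaField

end Literature.NumberTheory.Transcendental
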